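import Summits.CriticalPhenomena.PercolationContinuityZ3.Theorems.PercNearOneGluingNoHeavyLowerTailSahiCombTriWAndClaw

/-!
# The claw theorem in ABSTRACT form: a claw-structured tuple of `K`-vectors has non-negative Gram sum (joint realization lemma)

Support file of the one-cut programme (crux `NoHeavyLowerTail`, stmt-CriticalPhenomena-4575; unit `prim-lf-1` gen 49), continuation of
`…SahiCombTriWAndClaw`.  The claw theorem `corP_andProd_claw_nonneg` is stated for the concrete columns `clawU A`, `clawW A i` of an up-set `A` of the
product cube.  Here it is transported to ANY tuple `(u; w_0, …, w_{a-1})` of integer functions on an antipode-free up-set `P₁` satisfying the K-facts of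
those columns (values in `{-1,0,1}`, increasing, `w_i ≤ u`, pair conditions `u(x)+u(x') ≥ 0`, `u(x)+w_i(x') ≥ 0`, `w_i(x)+w_j(x') ≥ 0 (i ≠ j)` for
`x ∪ x' = ⊤`): such a tuple IS the column tuple of the up-set `clawRealize P₁ u w ⊆ 2^{γ₁ ⊕ Fin a}` (the up-closure of the forced points; a joint version of the
realization lemma `sgnDiff_realize_eq` of gen 43), hence
* **`sum_clawTuple_nonneg`** (`a ≥ 3`): `0 ≤ Σ_{x∈P₁} [u u' + Σ_i w_i w_i']` for two such tuples, whenever `Cor_{P₁} ≥ 0` on up-set pairs.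
USE (memo `FROM-prim-lf-1-gen49-CLAW.md` §3, the paper theorem): for the claw with ANY number `a ≥ 3` of doubled prongs the extra columns `v_1..v_a` together with
the second-largest sorted co-atom column `c` form such a tuple `(c; v_1..v_a)`, so `Σ_x [cc' + Σ v_i v_i'] ≥ 0`, which with the slack of the claw main lemma
proves `Cor_{P₁ ∧ Q(2^a,1^m)} ≥ 0` (next file).
HONEST LABEL: complete proofs, std axioms; one new definition (`clawRealize`). [this work]
-/

namespace Summit.CriticalPhenomena.PercolationContinuityZ3.Theorems

namespace FiveUpSet

open Finset

variable {γ₁ : Type} [DecidableEq γ₁] [Fintype γ₁] {a : ℕ}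

/-- The up-set of `2^{γ₁ ⊕ Fin a}` realizing a claw-structured tuple `(u; w)` on `P₁`: the up-closure of the forced points
`x⊔⊤ (u x = 1)`, `xᶜ⊔⊥ (u x = -1)`, `x⊔(⊤−i) (w_i x = 1)`, `xᶜ⊔{i} (w_i x = -1)`. [this work] -/
def clawRealize (P₁ : Finset (Finset γ₁)) (u : Finset γ₁ → ℤ) (w : Fin a → Finset γ₁ → ℤ) : Finset (Finset (γ₁ ⊕ Fin a)) :=
  univ.filter fun t =>
    (∃ x ∈ P₁, u x = 1 ∧ x.disjSum univ ⊆ t) ∨ (∃ x ∈ P₁, u x = -1 ∧ xᶜ.disjSum ∅ ⊆ t)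
    ∨ (∃ x ∈ P₁, ∃ i : Fin a, w i x = 1 ∧ x.disjSum (univ.erase i) ⊆ t) ∨ (∃ x ∈ P₁, ∃ i : Fin a, w i x = -1 ∧ xᶜ.disjSum {i} ⊆ t)

/-- Membership in the realizing family. [this work] -/
theorem mem_clawRealize {P₁ : Finset (Finset γ₁)} {u : Finset γ₁ → ℤ} {w : Fin a → Finset γ₁ → ℤ} {t : Finset (γ₁ ⊕ Fin a)} :
    t ∈ clawRealize P₁ u w ↔
      (∃ x ∈ P₁, u x = 1 ∧ x.disjSum univ ⊆ t) ∨ (∃ x ∈ P₁, u x = -1 ∧ xᶜ.disjSum ∅ ⊆ t)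
      ∨ (∃ x ∈ P₁, ∃ i : Fin a, w i x = 1 ∧ x.disjSum (univ.erase i) ⊆ t) ∨ (∃ x ∈ P₁, ∃ i : Fin a, w i x = -1 ∧ xᶜ.disjSum {i} ⊆ t) := by
  unfold clawRealize; rw [mem_filter]; simp only [mem_univ, true_and]

/-- The realizing family is an up-set. [this work] -/
theorem isUpperSet_clawRealize (P₁ : Finset (Finset γ₁)) (u : Finset γ₁ → ℤ) (w : Fin a → Finset γ₁ → ℤ) :
    IsUpperSet (clawRealize P₁ u w : Set (Finset (γ₁ ⊕ Fin a))) := by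
  intro t t' htt' ht
  rw [mem_coe, mem_clawRealize] at ht ⊢
  rcases ht with ⟨x, hx, h1, h2⟩ | ⟨x, hx, h1, h2⟩ | ⟨x, hx, i, h1, h2⟩ | ⟨x, hx, i, h1, h2⟩
  · exact Or.inl ⟨x, hx, h1, h2.trans htt'⟩
  · exact Or.inr (Or.inl ⟨x, hx, h1, h2.trans htt'⟩)
  · exact Or.inr (Or.inr (Or.inl ⟨x, hx, i, h1, h2.trans htt'⟩))
  · exact Or.inr (Or.inr (Or.inr ⟨x, hx, i, h1, h2.trans htt'⟩))

omit [DecidableEq γ₁] [Fintype γ₁] in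
/-- Componentwise reading of an inclusion between points of the product cube. [this work] -/
theorem disjSum_subset_disjSum_iff {x x' : Finset γ₁} {y y' : Finset (Fin a)} : x.disjSum y ⊆ x'.disjSum y' ↔ x ⊆ x' ∧ y ⊆ y' := by
  constructor
  · intro h
    constructor
    · have := toLeft_subset_toLeft h; rwa [toLeft_disjSum, toLeft_disjSum] at this
    · have := toRight_subset_toRight h; rwa [toRight_disjSum, toRight_disjSum] at this
  · rintro ⟨h1, h2⟩; exact disjSum_mono h1 h2

section realize
variable {P₁ : Finset (Finset γ₁)} (hP : IsUpperSet (P₁ : Set (Finset γ₁))) (hd : Disjoint P₁ (refl P₁))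
  {u : Finset γ₁ → ℤ} {w : Fin a → Finset γ₁ → ℤ}
  (hu : ∀ x ∈ P₁, u x = -1 ∨ u x = 0 ∨ u x = 1) (hw : ∀ i, ∀ x ∈ P₁, w i x = -1 ∨ w i x = 0 ∨ w i x = 1)
  (hum : ∀ x ∈ P₁, ∀ x' ∈ P₁, x ⊆ x' → u x ≤ u x') (hwm : ∀ i, ∀ x ∈ P₁, ∀ x' ∈ P₁, x ⊆ x' → w i x ≤ w i x')
  (hwu : ∀ i, ∀ x ∈ P₁, w i x ≤ u x)
  (huu : ∀ x ∈ P₁, ∀ x' ∈ P₁, x ∪ x' = univ → 0 ≤ u x + u x')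
  (huw : ∀ i, ∀ x ∈ P₁, ∀ x' ∈ P₁, x ∪ x' = univ → 0 ≤ u x + w i x')
  (hww : ∀ i j, i ≠ j → ∀ x ∈ P₁, ∀ x' ∈ P₁, x ∪ x' = univ → 0 ≤ w i x + w j x')

include hP hd in
/-- In an antipode-free up-set no member lies inside the complement of another. [this work] -/
theorem not_subset_compl_of_mem {x₀ x : Finset γ₁} (hx₀ : x₀ ∈ P₁) (hx : x ∈ P₁) (h : x₀ ⊆ xᶜ) : False := by
  have hxc : xᶜ ∈ P₁ := hP h hx₀
  exact disjoint_left.1 hd hx (mem_refl.2 hxc)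

/-- `x₀ᶜ ⊆ x` means `x₀ ∪ x = ⊤`. [this work] -/
theorem union_eq_univ_of_compl_subset {x₀ x : Finset γ₁} (h : x₀ᶜ ⊆ x) : x₀ ∪ x = univ := by
  apply eq_univ_of_forall; intro b; rw [mem_union]
  by_cases hb : b ∈ x₀
  · exact Or.inl hb
  · exact Or.inr (h (mem_compl.2 hb))

include hu hum hwm hwu huu huw in
/-- The top point of the row of `x ∈ P₁` is realized iff `u x = 1`. [this work] -/
theorem top_mem_clawRealize_iff {x : Finset γ₁} (hx : x ∈ P₁) : x.disjSum univ ∈ clawRealize P₁ u w ↔ u x = 1 := by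
  rw [mem_clawRealize]
  constructor
  · rintro (⟨x₀, hx₀, h1, h2⟩ | ⟨x₀, hx₀, h1, h2⟩ | ⟨x₀, hx₀, i, h1, h2⟩ | ⟨x₀, hx₀, i, h1, h2⟩) <;>
      rw [disjSum_subset_disjSum_iff] at h2
    · have := hum x₀ hx₀ x hx h2.1; rcases hu x hx with h | h | h <;> omega
    · have := huu x₀ hx₀ x hx (union_eq_univ_of_compl_subset h2.1); rcases hu x hx with h | h | h <;> omega
    · have := hwm i x₀ hx₀ x hx h2.1; have := hwu i x hx; rcases hu x hx with h | h | h <;> omega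
    · have := huw i x hx x₀ hx₀ (by rw [union_comm]; exact union_eq_univ_of_compl_subset h2.1)
      rcases hu x hx with h | h | h <;> omega
  · intro h; exact Or.inl ⟨x, hx, h, Subset.rfl⟩

include hP hd hu hum in
/-- The bottom point of the complementary row is realized iff `u x = -1`. [this work] -/
theorem bot_mem_clawRealize_iff {x : Finset γ₁} (hx : x ∈ P₁) : xᶜ.disjSum ∅ ∈ clawRealize P₁ u w ↔ u x = -1 := by
  rw [mem_clawRealize]
  constructor
  · rintro (⟨x₀, hx₀, h1, h2⟩ | ⟨x₀, hx₀, h1, h2⟩ | ⟨x₀, hx₀, i, h1, h2⟩ | ⟨x₀, hx₀, i, h1, h2⟩) <;>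
      rw [disjSum_subset_disjSum_iff] at h2
    · exact (not_subset_compl_of_mem hP hd hx₀ hx h2.1).elim
    · have := hum x hx x₀ hx₀ (compl_subset_compl.1 h2.1); rcases hu x hx with h | h | h <;> omega
    · exact (not_subset_compl_of_mem hP hd hx₀ hx h2.1).elim
    · exact absurd (h2.2 (mem_singleton_self i)) (by simp)
  · intro h; exact Or.inr (Or.inl ⟨x, hx, h, Subset.rfl⟩)

include hw hwm huw hww in
/-- The co-atom point `x ⊔ (⊤−i)` is realized iff `w_i x = 1`. [this work] -/
theorem coatom_mem_clawRealize_iff {x : Finset γ₁} (hx : x ∈ P₁) (i : Fin a) :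
    x.disjSum (univ.erase i) ∈ clawRealize P₁ u w ↔ w i x = 1 := by
  rw [mem_clawRealize]
  constructor
  · rintro (⟨x₀, hx₀, h1, h2⟩ | ⟨x₀, hx₀, h1, h2⟩ | ⟨x₀, hx₀, j, h1, h2⟩ | ⟨x₀, hx₀, j, h1, h2⟩) <;>
      rw [disjSum_subset_disjSum_iff] at h2
    · exact absurd (h2.2 (mem_univ i)) (by simp)
    · have := huw i x₀ hx₀ x hx (union_eq_univ_of_compl_subset h2.1); rcases hw i x hx with h | h | h <;> omega
    · have hij : j = i := by
        by_contra hne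
        have : i ∈ univ.erase j := mem_erase.2 ⟨fun h => hne h.symm, mem_univ i⟩
        exact (mem_erase.1 (h2.2 this)).1 rfl
      subst hij
      have := hwm j x₀ hx₀ x hx h2.1; rcases hw j x hx with h | h | h <;> omega
    · have hij : j ≠ i := fun h => by
        have := h2.2 (mem_singleton_self j); rw [h] at this; exact (mem_erase.1 this).1 rfl
      have := hww j i hij x₀ hx₀ x hx (union_eq_univ_of_compl_subset h2.1); rcases hw i x hx with h | h | h <;> omega
  · intro h; exact Or.inr (Or.inr (Or.inl ⟨x, hx, i, h, Subset.rfl⟩))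

include hP hd hw hum hwm hwu in
/-- The atom point `xᶜ ⊔ {i}` is realized iff `w_i x = -1`. [this work] -/
theorem atom_mem_clawRealize_iff {x : Finset γ₁} (hx : x ∈ P₁) (i : Fin a) :
    xᶜ.disjSum {i} ∈ clawRealize P₁ u w ↔ w i x = -1 := by
  rw [mem_clawRealize]
  constructor
  · rintro (⟨x₀, hx₀, h1, h2⟩ | ⟨x₀, hx₀, h1, h2⟩ | ⟨x₀, hx₀, j, h1, h2⟩ | ⟨x₀, hx₀, j, h1, h2⟩) <;>
      rw [disjSum_subset_disjSum_iff] at h2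
    · exact (not_subset_compl_of_mem hP hd hx₀ hx h2.1).elim
    · have := hum x hx x₀ hx₀ (compl_subset_compl.1 h2.1); have := hwu i x hx
      rcases hw i x hx with h | h | h <;> omega
    · exact (not_subset_compl_of_mem hP hd hx₀ hx h2.1).elim
    · have hij : j = i := by have := h2.2 (mem_singleton_self j); rwa [mem_singleton] at this
      subst hij
      have := hwm j x hx x₀ hx₀ (compl_subset_compl.1 h2.1); rcases hw j x hx with h | h | h <;> omega
  · intro h; exact Or.inr (Or.inr (Or.inr ⟨x, hx, i, h, Subset.rfl⟩))

include hP hd hu hum hwm hwu huu huw in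
/-- **Joint realization, top column.** [this work] -/
theorem clawU_clawRealize {x : Finset γ₁} (hx : x ∈ P₁) : clawU (clawRealize P₁ u w) x = u x := by
  have h1 := top_mem_clawRealize_iff (w := w) hu hum hwm hwu huu huw hx
  have h2 := bot_mem_clawRealize_iff (w := w) hP hd hu hum hx
  rw [clawU_eq]
  unfold ind
  rcases hu x hx with h | h | h
  · rw [if_neg (fun h' => by rw [h1] at h'; omega), if_pos (h2.2 h)]; omega
  · rw [if_neg (fun h' => by rw [h1] at h'; omega), if_neg (fun h' => by rw [h2] at h'; omega)]; omega
  · rw [if_pos (h1.2 h), if_neg (fun h' => by rw [h2] at h'; omega)]; omega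

include hP hd hw hum hwm hwu huw hww in
/-- **Joint realization, co-atom columns.** [this work] -/
theorem clawW_clawRealize {x : Finset γ₁} (hx : x ∈ P₁) (i : Fin a) : clawW (clawRealize P₁ u w) i x = w i x := by
  have h1 := coatom_mem_clawRealize_iff (u := u) hw hwm huw hww hx i
  have h2 := atom_mem_clawRealize_iff hP hd hw hum hwm hwu hx i
  rw [clawW_eq]
  unfold ind
  rcases hw i x hx with h | h | h
  · rw [if_neg (fun h' => by rw [h1] at h'; omega), if_pos (h2.2 h)]; omega
  · rw [if_neg (fun h' => by rw [h1] at h'; omega), if_neg (fun h' => by rw [h2] at h'; omega)]; omega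
  · rw [if_pos (h1.2 h), if_neg (fun h' => by rw [h2] at h'; omega)]; omega

end realize

/-- **THE CLAW THEOREM, ABSTRACT FORM.**  Two claw-structured tuples `(u; w_i)`, `(u'; w'_i)` (`i < a`, `a ≥ 3`) of functions on an antipode-free up-set
`P₁` with `Cor_{P₁} ≥ 0` on up-set pairs have `Σ_{x∈P₁} [u u' + Σ_i w_i w'_i] ≥ 0`. [this work] -/
theorem sum_clawTuple_nonneg (ha : 3 ≤ a) {P₁ : Finset (Finset γ₁)} (hP : IsUpperSet (P₁ : Set (Finset γ₁))) (hd : Disjoint P₁ (refl P₁))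
    (hcor : ∀ U V : Finset (Finset γ₁), IsUpperSet (U : Set (Finset γ₁)) → IsUpperSet (V : Set (Finset γ₁)) → 0 ≤ corP P₁ U V)
    (u u' : Finset γ₁ → ℤ) (w w' : Fin a → Finset γ₁ → ℤ)
    (hu : ∀ x ∈ P₁, u x = -1 ∨ u x = 0 ∨ u x = 1) (hw : ∀ i, ∀ x ∈ P₁, w i x = -1 ∨ w i x = 0 ∨ w i x = 1)
    (hum : ∀ x ∈ P₁, ∀ x' ∈ P₁, x ⊆ x' → u x ≤ u x') (hwm : ∀ i, ∀ x ∈ P₁, ∀ x' ∈ P₁, x ⊆ x' → w i x ≤ w i x')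
    (hwu : ∀ i, ∀ x ∈ P₁, w i x ≤ u x)
    (huu : ∀ x ∈ P₁, ∀ x' ∈ P₁, x ∪ x' = univ → 0 ≤ u x + u x')
    (huw : ∀ i, ∀ x ∈ P₁, ∀ x' ∈ P₁, x ∪ x' = univ → 0 ≤ u x + w i x')
    (hww : ∀ i j, i ≠ j → ∀ x ∈ P₁, ∀ x' ∈ P₁, x ∪ x' = univ → 0 ≤ w i x + w j x')
    (hu' : ∀ x ∈ P₁, u' x = -1 ∨ u' x = 0 ∨ u' x = 1) (hw' : ∀ i, ∀ x ∈ P₁, w' i x = -1 ∨ w' i x = 0 ∨ w' i x = 1)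
    (hum' : ∀ x ∈ P₁, ∀ x' ∈ P₁, x ⊆ x' → u' x ≤ u' x') (hwm' : ∀ i, ∀ x ∈ P₁, ∀ x' ∈ P₁, x ⊆ x' → w' i x ≤ w' i x')
    (hwu' : ∀ i, ∀ x ∈ P₁, w' i x ≤ u' x)
    (huu' : ∀ x ∈ P₁, ∀ x' ∈ P₁, x ∪ x' = univ → 0 ≤ u' x + u' x')
    (huw' : ∀ i, ∀ x ∈ P₁, ∀ x' ∈ P₁, x ∪ x' = univ → 0 ≤ u' x + w' i x')
    (hww' : ∀ i j, i ≠ j → ∀ x ∈ P₁, ∀ x' ∈ P₁, x ∪ x' = univ → 0 ≤ w' i x + w' j x') :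
    0 ≤ ∑ x ∈ P₁, (u x * u' x + ∑ i : Fin a, w i x * w' i x) := by
  have h := corP_andProd_claw_nonneg hP hd hcor (isUpperSet_clawRealize P₁ u w) (isUpperSet_clawRealize P₁ u' w') ha
  rw [corP_andProd_claw_eq] at h
  refine h.trans (le_of_eq (sum_congr rfl fun x hx => ?_))
  rw [clawU_clawRealize hP hd hu hum hwm hwu huu huw hx, clawU_clawRealize hP hd hu' hum' hwm' hwu' huu' huw' hx]
  congr 1
  exact sum_congr rfl fun i _ => by
    rw [clawW_clawRealize hP hd hw hum hwm hwu huw hww hx i, clawW_clawRealize hP hd hw' hum' hwm' hwu' huw' hww' hx i]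

/-- **The claw theorem, abstract form, arbitrary finite index type** (`3 ≤ card ι`). [this work] -/
theorem sum_clawTuple_nonneg' {ι : Type} [Fintype ι] [DecidableEq ι] (hι : 3 ≤ Fintype.card ι) {P₁ : Finset (Finset γ₁)}
    (hP : IsUpperSet (P₁ : Set (Finset γ₁))) (hd : Disjoint P₁ (refl P₁))
    (hcor : ∀ U V : Finset (Finset γ₁), IsUpperSet (U : Set (Finset γ₁)) → IsUpperSet (V : Set (Finset γ₁)) → 0 ≤ corP P₁ U V)
    (u u' : Finset γ₁ → ℤ) (w w' : ι → Finset γ₁ → ℤ)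
    (hu : ∀ x ∈ P₁, u x = -1 ∨ u x = 0 ∨ u x = 1) (hw : ∀ i, ∀ x ∈ P₁, w i x = -1 ∨ w i x = 0 ∨ w i x = 1)
    (hum : ∀ x ∈ P₁, ∀ x' ∈ P₁, x ⊆ x' → u x ≤ u x') (hwm : ∀ i, ∀ x ∈ P₁, ∀ x' ∈ P₁, x ⊆ x' → w i x ≤ w i x')
    (hwu : ∀ i, ∀ x ∈ P₁, w i x ≤ u x)
    (huu : ∀ x ∈ P₁, ∀ x' ∈ P₁, x ∪ x' = univ → 0 ≤ u x + u x')
    (huw : ∀ i, ∀ x ∈ P₁, ∀ x' ∈ P₁, x ∪ x' = univ → 0 ≤ u x + w i x')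
    (hww : ∀ i j, i ≠ j → ∀ x ∈ P₁, ∀ x' ∈ P₁, x ∪ x' = univ → 0 ≤ w i x + w j x')
    (hu' : ∀ x ∈ P₁, u' x = -1 ∨ u' x = 0 ∨ u' x = 1) (hw' : ∀ i, ∀ x ∈ P₁, w' i x = -1 ∨ w' i x = 0 ∨ w' i x = 1)
    (hum' : ∀ x ∈ P₁, ∀ x' ∈ P₁, x ⊆ x' → u' x ≤ u' x') (hwm' : ∀ i, ∀ x ∈ P₁, ∀ x' ∈ P₁, x ⊆ x' → w' i x ≤ w' i x')
    (hwu' : ∀ i, ∀ x ∈ P₁, w' i x ≤ u' x)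
    (huu' : ∀ x ∈ P₁, ∀ x' ∈ P₁, x ∪ x' = univ → 0 ≤ u' x + u' x')
    (huw' : ∀ i, ∀ x ∈ P₁, ∀ x' ∈ P₁, x ∪ x' = univ → 0 ≤ u' x + w' i x')
    (hww' : ∀ i j, i ≠ j → ∀ x ∈ P₁, ∀ x' ∈ P₁, x ∪ x' = univ → 0 ≤ w' i x + w' j x') :
    0 ≤ ∑ x ∈ P₁, (u x * u' x + ∑ i : ι, w i x * w' i x) := by
  set e := Fintype.equivFin ι
  have h := sum_clawTuple_nonneg (a := Fintype.card ι) hι hP hd hcor u u' (fun i => w (e.symm i)) (fun i => w' (e.symm i))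
    hu (fun i => hw (e.symm i)) hum (fun i => hwm (e.symm i)) (fun i => hwu (e.symm i)) huu (fun i => huw (e.symm i))
    (fun i j hij => hww (e.symm i) (e.symm j) (fun h' => hij (e.symm.injective h')))
    hu' (fun i => hw' (e.symm i)) hum' (fun i => hwm' (e.symm i)) (fun i => hwu' (e.symm i)) huu' (fun i => huw' (e.symm i))
    (fun i j hij => hww' (e.symm i) (e.symm j) (fun h' => hij (e.symm.injective h')))
  refine h.trans (le_of_eq (sum_congr rfl fun x _ => ?_))
  congr 1
  exact Equiv.sum_comp e.symm (fun i => w i x * w' i x)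

end FiveUpSet

end Summit.CriticalPhenomena.PercolationContinuityZ3.Theorems
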